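import Mathlib
import HarnessLib
import Literature.MathematicalPhysics.QuantumLattice.FermiRG.BGM2006AppA
import Summits.HubbardSuperconductivity.HubbardSuperconductivity.Theorems.KLProgrammeH10TwoPointLimitRelativeSectorCount

/-!
# Route `KLProgramme` — crux K1 `H10TwoPointLimit` (stmt-HubbardSuperconductivity-19938):
# the «one determined leg» count in BGM's own sector vocabulary (the s-sectors `S_{h,ω}` of (2.69) as typed in
# `FermiRG/BGM2006AppA.lean`), modulo `2πℤ²`, for the Hubbard band

`Literature.MathematicalPhysics.QuantumLattice.FermiRG.BGM2006AppA.LemmaA31` types Benfatto–Giuliani–Mastropietro's anisotropic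
relative Sector Counting Lemma A3.1 (conservation `Σ εᵢ kᵢ = 0` in `ℝ²`, exponent `(L-3)/2`) as a predicate on an abstract
dispersion family — a FACT for BGM's low-density instance. At intermediate filling momentum is conserved modulo `2πℤ²` and that
exponent is FALSE for the Hubbard band (umklapp corners; HOME/prover-p4/COUNTING-NOTE-2.md, Prop. N). This file proves, for the
free Hubbard family `eps h = sqDispersion` (`γ = 4`) and the s-sectors `BGM2006AppA.sSector 4 e₀ μ (fun _ => sqDispersion) h ω`,
the bound Paper 1 (K1 = H1.0) uses instead — **the last leg is determined up to `O(L)` fine sectors**, uniformly in the umklapp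
class `G ∈ ℤ²`, in the signs and in the other legs' (scale-`h`) sector indices:

* `sSector_cell` — a momentum of the closed square in `S_{h,ω}` is within `4^h e₀/Dt_min + s_max·(3w_n/4)` of the curve point at
  the sector centre `(ω + ½)w_n` (`n = scaleIdx h = -h`, `w_n = π/2ⁿ = πγ^{h/2}`);
* `bgm_lastLeg_count_le` — given the scale-`h` indices of `m` other legs (any `m`, any signs `sᵢ = ±1`, `t = ±1`), the number of
  `ω < |O_h|` such that momenta `kᵢ ∈ S_{h,ωᵢ}`, `k ∈ S_{h,ω}` of the closed square exist with `Σ sᵢ kᵢ + t k ∈ 2πG` (G fixed,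
  arbitrary) is `≤ 3 (2π √2 (m+1) ρ_h/(u_min w_n) + 1)`, `ρ_h = 4^h e₀/Dt_min + 3 s_max w_n/4`;
* `bgm_lastLeg_count_le'` — since `4^h e₀ ≤ e₀ w_n/π`-wise (`4^h/w_n = 2^h/π ≤ 1/π` for `h ≤ 0`) this is
  `≤ 3 (2π √2 (m+1) (e₀/(π Dt_min) + 3 s_max/4)/u_min + 1)` — a constant times `L = m + 1`, at every scale `h ≤ 0`.

* `lemmaA31_mod_oneDeterminedLeg` — **the provable replacement of Lemma A3.1 modulo `2πℤ²`** in the typed shape of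
  `BGM2006AppA.LemmaA31`: scales `h' ≤ h ≤ 0`, a fixed fine index `ω₁`, coarse indices `ωc` (`BGM2006AppA.Refines`), charges, an
  umklapp class `G`; the number (`Set.ncard`) of fine refinements `ω' ≺ ωc` whose s-sectors together with `S_{h',ω₁}` admit momenta of
  the closed square with signed sum `2πG` is `≤ (2^{n'-n})^{L-2} · 3 (2π √2 L ρ̄/u_min + 1)` = `c_L γ^{(h-h')(L-2)/2}` (`L - 2` free
  refined legs, the last one determined) — exponent `(L-2)/2` where print has `(L-3)/2`.

This is input (V) of Theorem 2.1 for Paper 1 (COUNTING-NOTE-2 §5(b′)); the momenta are restricted to the closed square `[-π, π]²`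
(BGM's `k⃗` live in the Brillouin zone; the typed `sSector` does not say so). Everything is proved; no definitions, no named facts.
References: BGM 2006 (Ann. Henri Poincaré 7, 809) §2.7 (2.69), §2.8 (2.89), App. A3 [cite: BenfattoGiulianiMastropietro2006];
HOME/prover-p4/COUNTING-NOTE-2.md.
-/

noncomputable section

namespace Summit.HubbardSuperconductivity.HubbardSuperconductivity.Theorems.RelativeSectorCount

set_option linter.dupNamespace false -- summit = problem name (single-conjunct summit), D-0017

open Classical
open Real Set
open Literature.MathematicalPhysics.QuantumLattice Literature.MathematicalPhysics.QuantumLattice.BandSectorCounting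
open Literature.MathematicalPhysics.QuantumLattice.FermiRG.BGM2006AppA (sSector anisoCount scaleIdx)

section BGM

variable {a b : ℝ} (B : BandBounds a b) {μ : ℝ} (hμ : μ ∈ Icc a b)
include B hμ

/-- **The typed s-sectors of BGM (2.69) are cells** (free Hubbard family `eps h = ε`, `γ = 4`): a momentum of the closed square in
`S_{h,ω} = {|ε - μ| ≤ 4^h e₀, ζ_{n,ω}(θ(k)) ≠ 0}` is within `4^h e₀/Dt_min + s_max (3w_n/4)` of `p_μ((ω + ½)w_n)`, coordinatewise,
provided `μ ± 4^h e₀` lies in the level range. [cite: BenfattoGiulianiMastropietro2006, §2.7 (2.69)] -/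
theorem sSector_cell {e₀ : ℝ} {h : ℤ} {ω : ℕ} {k : Fin 2 → ℝ}
    (hk : k ∈ sSector 4 e₀ μ (fun _ => sqDispersion) h ω) (hsq : ∀ c, |k c| ≤ π)
    (hlo : a ≤ μ - (4 : ℝ) ^ h * e₀) (hhi : μ + (4 : ℝ) ^ h * e₀ ≤ b) :
    |k 0 - bandX μ (((ω : ℝ) + 1 / 2) * sectorWidth (scaleIdx h))| ≤
        (4 : ℝ) ^ h * e₀ / B.Dtmin + B.smax * (3 * sectorWidth (scaleIdx h) / 4) ∧
      |k 1 - bandY μ (((ω : ℝ) + 1 / 2) * sectorWidth (scaleIdx h))| ≤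
        (4 : ℝ) ^ h * e₀ / B.Dtmin + B.smax * (3 * sectorWidth (scaleIdx h) / 4) := by
  obtain ⟨hshell, hζ⟩ := hk
  -- angular support of `ζ_{n,ω}`: some translate of the polar angle is within `3w/4` of the centre
  have hang : ∃ j : ℤ, |polarAngle k - ((ω : ℝ) + 1 / 2) * sectorWidth (scaleIdx h) - 2 * π * j| <
      3 * sectorWidth (scaleIdx h) / 4 := by
    by_contra hc
    push Not at hc
    exact hζ (sectorWeightCirc_eq_zero (by exact_mod_cast hc))
  obtain ⟨j, hj⟩ := hang
  have hang' : |Complex.arg (⟨k 0, k 1⟩ : ℂ) + (-j : ℤ) * (2 * π) - ((ω : ℝ) + 1 / 2) * sectorWidth (scaleIdx h)| ≤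
      3 * sectorWidth (scaleIdx h) / 4 := by
    rw [← momToComplex_eq_mk]
    have : Complex.arg (momToComplex k) + ((-j : ℤ) : ℝ) * (2 * π) - ((ω : ℝ) + 1 / 2) * sectorWidth (scaleIdx h) =
        polarAngle k - ((ω : ℝ) + 1 / 2) * sectorWidth (scaleIdx h) - 2 * π * j := by
      rw [polarAngle]; push_cast; ring
    rw [this]; exact hj.le
  exact cell_of_level_of_angle B hμ hsq hshell hlo hhi hang'

/-- **The last leg is determined, in BGM's vocabulary** (input (V) of Paper 1's Theorem 2.1, fibre form). Scale `h` (`n = -h`,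
`|O_h| = anisoCount h` sectors of width `w_n`), `m` other legs with scale-`h` indices `ωo i` and signs `s i = ±1`, the counted
leg with sign `t = ±1`, umklapp class `G ∈ ℤ²`: the number of `ω < |O_h|` for which momenta of the closed square `kᵢ ∈ S_{h,ωo i}`,
`k ∈ S_{h,ω}` with `Σᵢ sᵢ kᵢ + t k = 2πG` exist is `≤ 3 (2π √2 ((m+1) ρ_h)/(u_min w_n) + 1)`, `ρ_h = 4^h e₀/Dt_min + 3 s_max w_n/4`
— independent of `G`, of the signs and of the `ωo i`. [cite: BenfattoGiulianiMastropietro2006, §2.8 (2.89), App. A3] -/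
theorem bgm_lastLeg_count_le {e₀ : ℝ} {h : ℤ}
    (hlo : a ≤ μ - (4 : ℝ) ^ h * e₀) (hhi : μ + (4 : ℝ) ^ h * e₀ ≤ b) (he : 0 ≤ e₀)
    {m : ℕ} (ωo : Fin m → ℕ) (s : Fin m → ℝ) (hs : ∀ i, s i = 1 ∨ s i = -1) (t : ℝ) (ht : t = 1 ∨ t = -1)
    (G : Fin 2 → ℤ) :
    ((((Finset.range (anisoCount h)).filter fun ω : ℕ => ∃ ks : Fin m → Fin 2 → ℝ, ∃ k : Fin 2 → ℝ,
        (∀ i, ks i ∈ sSector 4 e₀ μ (fun _ => sqDispersion) h (ωo i) ∧ ∀ c, |ks i c| ≤ π) ∧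
        (k ∈ sSector 4 e₀ μ (fun _ => sqDispersion) h ω ∧ ∀ c, |k c| ≤ π) ∧
        ∀ c : Fin 2, (∑ i, s i * ks i c) + t * k c = 2 * π * G c).card : ℝ)) ≤
      3 * (2 * (π * (Real.sqrt 2 * (((m : ℝ) + 1) *
        ((4 : ℝ) ^ h * e₀ / B.Dtmin + B.smax * (3 * sectorWidth (scaleIdx h) / 4))) / B.umin)) / sectorWidth (scaleIdx h) + 1) := by
  set n := scaleIdx h with hn
  set w := sectorWidth n with hw
  set η := (4 : ℝ) ^ h * e₀ with hη
  set ρc := η / B.Dtmin + B.smax * (3 * w / 4) with hρc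
  have hwpos : 0 < w := sectorWidth_pos n
  have hN : (anisoCount h : ℝ) * w = 2 * π := by
    rw [show anisoCount h = sectorCount n from rfl]; exact sectorCount_mul_sectorWidth n
  have hη0 : 0 ≤ η := by rw [hη]; positivity
  have hα : 0 ≤ 3 * w / 4 := by positivity
  have hρc0 : 0 ≤ ρc := by have := B.Dtmin_pos; have := B.smax_pos; positivity
  -- the other legs as abstract cells
  set A : Fin m → Set (Fin 2 → ℝ) := fun i => {k | k ∈ sSector 4 e₀ μ (fun _ => sqDispersion) h (ωo i) ∧ ∀ c, |k c| ≤ π}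
    with hA
  set P : Fin m → Fin 2 → ℝ := fun i =>
    ![bandX μ (((ωo i : ℝ) + 1 / 2) * w), bandY μ (((ωo i : ℝ) + 1 / 2) * w)] with hP
  have hAP : ∀ i, ∀ k ∈ A i, ∀ c : Fin 2, |k c - P i c| ≤ (fun _ : Fin m => ρc) i := by
    intro i k hk c
    obtain ⟨hx, hy⟩ := sSector_cell B hμ hk.1 hk.2 hlo hhi
    fin_cases c
    · simpa [hP] using hx
    · simpa [hP] using hy
  have hmain := relCount_lastLeg_le B hμ hwpos hN hη0 hα hlo hhi A P (fun _ => ρc) (fun _ => hρc0) hAP s hs t ht G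
  have hsum : (∑ _i : Fin m, ρc) = (m : ℝ) * ρc := by simp [Finset.sum_const]
  rw [hsum] at hmain
  have hshape : (m : ℝ) * ρc + (η / B.Dtmin + B.smax * (3 * w / 4)) = ((m : ℝ) + 1) * ρc := by rw [hρc]; ring
  rw [hshape] at hmain
  refine le_trans ?_ hmain
  have hsub := Finset.monotone_filter_right (Finset.range (anisoCount h))
    (p := fun ω : ℕ => ∃ ks : Fin m → Fin 2 → ℝ, ∃ k : Fin 2 → ℝ,
        (∀ i, ks i ∈ sSector 4 e₀ μ (fun _ => sqDispersion) h (ωo i) ∧ ∀ c, |ks i c| ≤ π) ∧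
        (k ∈ sSector 4 e₀ μ (fun _ => sqDispersion) h ω ∧ ∀ c, |k c| ≤ π) ∧
        ∀ c : Fin 2, (∑ i, s i * ks i c) + t * k c = 2 * π * G c)
    (q := fun ω : ℕ => ∃ ks : Fin m → Fin 2 → ℝ, ∃ k : Fin 2 → ℝ,
        (∀ i, ks i ∈ A i) ∧ (∀ c, |k c| ≤ π) ∧ |sqDispersion k - μ| ≤ η ∧
        (∃ m : ℤ, |Complex.arg (⟨k 0, k 1⟩ : ℂ) + m * (2 * π) - (w / 2 + ω * w)| ≤ 3 * w / 4) ∧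
        ∀ c : Fin 2, (∑ i, s i * ks i c) + t * k c = 2 * π * G c)
    (fun ω _ hω => by
      obtain ⟨ks, k, hks, ⟨hk, hksq⟩, hsumc⟩ := hω
      refine ⟨ks, k, fun i => hks i, hksq, hk.1, ?_, hsumc⟩
      -- the angular window of the counted leg, from the support of `ζ_{n,ω}`
      have hang : ∃ j : ℤ, |polarAngle k - ((ω : ℝ) + 1 / 2) * sectorWidth n - 2 * π * j| < 3 * sectorWidth n / 4 := by
        by_contra hc
        push Not at hc
        exact hk.2 (sectorWeightCirc_eq_zero (by exact_mod_cast hc))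
      obtain ⟨j, hj⟩ := hang
      refine ⟨-j, ?_⟩
      rw [← momToComplex_eq_mk]
      have : Complex.arg (momToComplex k) + ((-j : ℤ) : ℝ) * (2 * π) - (w / 2 + ω * w) =
          polarAngle k - ((ω : ℝ) + 1 / 2) * sectorWidth n - 2 * π * j := by
        rw [polarAngle, hw]; push_cast; ring
      rw [this]; exact hj.le)
  exact_mod_cast Finset.card_le_card hsub

omit B hμ in
/-- For `h ≤ 0`: `4^h ≤ 2^h = w_n/π` with `n = scaleIdx h = -h`, so the radial tolerance `4^h e₀` is at most `e₀ w_n/π`.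
[folklore] -/
theorem zpow_four_le_sectorWidth {h : ℤ} (hh : h ≤ 0) :
    (4 : ℝ) ^ h ≤ sectorWidth (scaleIdx h) / π := by
  set n := scaleIdx h with hn
  have hn' : ((n : ℕ) : ℤ) = -h := by
    rw [hn, show scaleIdx h = (-h).toNat from rfl, Int.toNat_of_nonneg (by linarith)]
  have h4 : (4 : ℝ) ^ h = ((4 : ℝ) ^ n)⁻¹ := by
    rw [show h = -((n : ℕ) : ℤ) by rw [hn']; ring, zpow_neg, zpow_natCast]
  rw [h4, sectorWidth]
  rw [show π / (2 : ℝ) ^ n / π = ((2 : ℝ) ^ n)⁻¹ by field_simp]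
  rw [show ((4 : ℝ) ^ n) = (2 : ℝ) ^ n * (2 : ℝ) ^ n by rw [← mul_pow]; norm_num]
  rw [mul_inv]
  have h2 : (1 : ℝ) ≤ (2 : ℝ) ^ n := one_le_pow₀ (by norm_num)
  have hinv : ((2 : ℝ) ^ n)⁻¹ ≤ 1 := inv_le_one_of_one_le₀ h2
  calc ((2 : ℝ) ^ n)⁻¹ * ((2 : ℝ) ^ n)⁻¹ ≤ 1 * ((2 : ℝ) ^ n)⁻¹ :=
        mul_le_mul_of_nonneg_right hinv (by positivity)
    _ = ((2 : ℝ) ^ n)⁻¹ := one_mul _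

/-- **The last leg is determined up to `O(L)` sectors, uniformly in the scale** (the form Theorem 2.1 consumes: the constant does
not depend on `h ≤ 0`): with `ρ̄ = e₀/(π Dt_min) + 3 s_max/4` the count of `bgm_lastLeg_count_le` is
`≤ 3 (2π √2 (m+1) ρ̄/u_min + 1)`. [cite: BenfattoGiulianiMastropietro2006, §2.8 (2.89), App. A3] -/
theorem bgm_lastLeg_count_le' {e₀ : ℝ} {h : ℤ} (hh : h ≤ 0)
    (hlo : a ≤ μ - (4 : ℝ) ^ h * e₀) (hhi : μ + (4 : ℝ) ^ h * e₀ ≤ b) (he : 0 ≤ e₀)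
    {m : ℕ} (ωo : Fin m → ℕ) (s : Fin m → ℝ) (hs : ∀ i, s i = 1 ∨ s i = -1) (t : ℝ) (ht : t = 1 ∨ t = -1)
    (G : Fin 2 → ℤ) :
    ((((Finset.range (anisoCount h)).filter fun ω : ℕ => ∃ ks : Fin m → Fin 2 → ℝ, ∃ k : Fin 2 → ℝ,
        (∀ i, ks i ∈ sSector 4 e₀ μ (fun _ => sqDispersion) h (ωo i) ∧ ∀ c, |ks i c| ≤ π) ∧
        (k ∈ sSector 4 e₀ μ (fun _ => sqDispersion) h ω ∧ ∀ c, |k c| ≤ π) ∧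
        ∀ c : Fin 2, (∑ i, s i * ks i c) + t * k c = 2 * π * G c).card : ℝ)) ≤
      3 * (2 * (π * (Real.sqrt 2 * (((m : ℝ) + 1) * (e₀ / (π * B.Dtmin) + B.smax * (3 / 4))) / B.umin)) + 1) := by
  refine (bgm_lastLeg_count_le B hμ hlo hhi he ωo s hs t ht G).trans ?_
  set w := sectorWidth (scaleIdx h) with hw
  have hwpos : 0 < w := sectorWidth_pos _
  have hD := B.Dtmin_pos; have hS := B.smax_pos; have hU := B.umin_pos
  have h4 : (4 : ℝ) ^ h * e₀ ≤ w / π * e₀ := mul_le_mul_of_nonneg_right (zpow_four_le_sectorWidth hh) he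
  -- `ρ_h ≤ w ρ̄`
  have hρ : (4 : ℝ) ^ h * e₀ / B.Dtmin + B.smax * (3 * w / 4) ≤ w * (e₀ / (π * B.Dtmin) + B.smax * (3 / 4)) := by
    have h1 : (4 : ℝ) ^ h * e₀ / B.Dtmin ≤ w / π * e₀ / B.Dtmin := div_le_div_of_nonneg_right h4 hD.le
    have e : w / π * e₀ / B.Dtmin + B.smax * (3 * w / 4) = w * (e₀ / (π * B.Dtmin) + B.smax * (3 / 4)) := by
      field_simp
    linarith only [h1, e]
  have hm : (0 : ℝ) ≤ (m : ℝ) + 1 := by positivity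
  have key : 2 * (π * (Real.sqrt 2 * (((m : ℝ) + 1) * ((4 : ℝ) ^ h * e₀ / B.Dtmin + B.smax * (3 * w / 4))) / B.umin)) / w ≤
      2 * (π * (Real.sqrt 2 * (((m : ℝ) + 1) * (e₀ / (π * B.Dtmin) + B.smax * (3 / 4))) / B.umin)) := by
    rw [div_le_iff₀ hwpos]
    have := mul_le_mul_of_nonneg_left hρ hm
    have e : 2 * (π * (Real.sqrt 2 * (((m : ℝ) + 1) * (e₀ / (π * B.Dtmin) + B.smax * (3 / 4))) / B.umin)) * w =
        2 * (π * (Real.sqrt 2 * (((m : ℝ) + 1) * (w * (e₀ / (π * B.Dtmin) + B.smax * (3 / 4)))) / B.umin)) := by ring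
    rw [e]
    gcongr
  linarith only [key]

/-- **Lemma A3.1 modulo `2πℤ²`, with ONE determined leg** — the provable replacement, for the Hubbard band at intermediate filling,
of BGM's anisotropic relative Sector Counting Lemma (typed as `BGM2006AppA.LemmaA31` with conservation in `ℝ²` and exponent
`(L-3)/2`; that exponent FAILS modulo `2πℤ²`, COUNTING-NOTE-2 Prop. N). In BGM's typed vocabulary: scales `h' ≤ h ≤ 0`, one fixed
fine index `ω₁ ∈ O_{h'}`, coarse indices `ωc : Fin (m'+1) → O_h`, charges `sgn`, umklapp class `G`; the number of fine refinements
`ω' ≺ ωc` (`BGM2006AppA.Refines`) whose s-sectors, together with `S_{h',ω₁}`, admit momenta of the closed square with signed sum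
`2πG` is at most `(2^{n'-n})^{m'} · 3 (2π √2 (m'+2) ρ̄/u_min + 1)` — i.e. `c_L γ^{(h-h')(L-2)/2}` with `L = m' + 2` legs,
`γ^{(h-h')/2} = 2^{n'-n}` children per coarse sector (`n = scaleIdx h`, `n' = scaleIdx h'`), `ρ̄ = e₀/(π Dt_min) + 3 s_max/4`:
all refined legs but the last are free, the last is determined (`bgm_lastLeg_count_le'`).
[cite: BenfattoGiulianiMastropietro2006, App. A3 Lemma A3.1] -/
theorem lemmaA31_mod_oneDeterminedLeg {e₀ : ℝ} {h' h : ℤ} (hh' : h' ≤ h) (hh : h ≤ 0)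
    (hlo : a ≤ μ - (4 : ℝ) ^ h' * e₀) (hhi : μ + (4 : ℝ) ^ h' * e₀ ≤ b) (he : 0 ≤ e₀)
    {m' : ℕ} (sgn : Fin (m' + 2) → Bool) (ω₁ : ℕ) (ωc : Fin (m' + 1) → ℕ) (hωc : ∀ i, ωc i < anisoCount h)
    (G : Fin 2 → ℤ) :
    (((setOf fun ω' : Fin (m' + 1) → ℕ => (∀ i, ω' i < anisoCount h') ∧
        (∀ i, Literature.MathematicalPhysics.QuantumLattice.FermiRG.BGM2006AppA.Refines h' h (ω' i) (ωc i)) ∧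
        ∃ k : Fin (m' + 2) → Fin 2 → ℝ, (∀ i c, |k i c| ≤ π) ∧
          k 0 ∈ sSector 4 e₀ μ (fun _ => sqDispersion) h' ω₁ ∧
          (∀ i : Fin (m' + 1), k i.succ ∈ sSector 4 e₀ μ (fun _ => sqDispersion) h' (ω' i)) ∧
          ∀ c : Fin 2, (∑ i, (if sgn i then k i c else -k i c)) = 2 * π * G c).ncard : ℕ) : ℝ) ≤
      ((2 : ℝ) ^ (scaleIdx h' - scaleIdx h)) ^ m' *
        (3 * (2 * (π * (Real.sqrt 2 * ((((m' + 1 : ℕ) : ℝ) + 1) * (e₀ / (π * B.Dtmin) + B.smax * (3 / 4))) / B.umin)) + 1)) := by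
  set n := scaleIdx h with hn
  set n' := scaleIdx h' with hn'
  have hnn : n ≤ n' := by
    rw [hn, hn', show scaleIdx h = (-h).toNat from rfl, show scaleIdx h' = (-h').toNat from rfl]
    exact Int.toNat_le_toNat (by linarith)
  -- signs as reals
  set s : Fin (m' + 2) → ℝ := fun i => if sgn i then 1 else -1 with hs
  have hs1 : ∀ i, s i = 1 ∨ s i = -1 := by intro i; rw [hs]; dsimp only; split_ifs <;> simp
  have hsk : ∀ (k : Fin (m' + 2) → Fin 2 → ℝ) i c, (if sgn i then k i c else -k i c) = s i * k i c := by
    intro k i c; rw [hs]; dsimp only; split_ifs <;> ring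
  -- the children of the coarse indices
  set ch : Fin (m' + 1) → Finset ℕ := fun i => (Finset.range (anisoCount h')).filter fun ω => ω / 2 ^ (n' - n) = ωc i
    with hch
  have hchcard : ∀ i, (ch i).card = 2 ^ (n' - n) := by
    intro i
    rw [hch]; dsimp only
    rw [show anisoCount h' = sectorCount n' from rfl]
    exact card_filter_div_eq hnn (by rw [← show anisoCount h = sectorCount n from rfl]; exact hωc i)
  -- the admissibility predicate of a full fine assignment
  set Adm : (Fin (m' + 1) → ℕ) → Prop := fun ω' => ∃ k : Fin (m' + 2) → Fin 2 → ℝ, (∀ i c, |k i c| ≤ π) ∧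
      k 0 ∈ sSector 4 e₀ μ (fun _ => sqDispersion) h' ω₁ ∧
      (∀ i : Fin (m' + 1), k i.succ ∈ sSector 4 e₀ μ (fun _ => sqDispersion) h' (ω' i)) ∧
      ∀ c : Fin 2, (∑ i, (if sgn i then k i c else -k i c)) = 2 * π * G c with hAdm
  set T : Finset (Fin (m' + 1) → ℕ) := (Fintype.piFinset ch).filter Adm with hT
  -- (1) the set is contained in `T`
  have hsubT : (setOf fun ω' : Fin (m' + 1) → ℕ => (∀ i, ω' i < anisoCount h') ∧
        (∀ i, Literature.MathematicalPhysics.QuantumLattice.FermiRG.BGM2006AppA.Refines h' h (ω' i) (ωc i)) ∧ Adm ω') ⊆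
      (T : Set (Fin (m' + 1) → ℕ)) := by
    intro ω' hω'
    obtain ⟨hlt, href, hadm⟩ := hω'
    rw [Finset.mem_coe, hT, Finset.mem_filter, Fintype.mem_piFinset]
    refine ⟨fun i => ?_, hadm⟩
    rw [hch]; dsimp only
    rw [Finset.mem_filter, Finset.mem_range]
    exact ⟨hlt i, (href i).2⟩
  have hncard : ((setOf fun ω' : Fin (m' + 1) → ℕ => (∀ i, ω' i < anisoCount h') ∧
        (∀ i, Literature.MathematicalPhysics.QuantumLattice.FermiRG.BGM2006AppA.Refines h' h (ω' i) (ωc i)) ∧ Adm ω').ncard : ℕ) ≤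
      T.card := by
    calc _ ≤ (T : Set (Fin (m' + 1) → ℕ)).ncard := Set.ncard_le_ncard hsubT (Finset.finite_toSet T)
      _ = T.card := Set.ncard_coe_finset T
  -- (2) fibre decomposition of `T` over the first `m'` coordinates
  set ch₀ : Fin m' → Finset ℕ := fun i => ch i.castSucc with hch₀
  have hmaps : Set.MapsTo (fun ω' : Fin (m' + 1) → ℕ => Fin.init ω') (T : Set (Fin (m' + 1) → ℕ))
      ((Fintype.piFinset ch₀ : Finset (Fin m' → ℕ)) : Set (Fin m' → ℕ)) := by
    intro ω' hω'
    rw [Finset.mem_coe, hT, Finset.mem_filter, Fintype.mem_piFinset] at hω'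
    rw [Finset.mem_coe, Fintype.mem_piFinset]
    intro i
    exact hω'.1 i.castSucc
  have hdec := Finset.card_eq_sum_card_fiberwise hmaps
  -- (3) each fibre is a last-leg count
  set bnd : ℝ := 3 * (2 * (π * (Real.sqrt 2 * ((((m' + 1 : ℕ) : ℝ) + 1) *
      (e₀ / (π * B.Dtmin) + B.smax * (3 / 4))) / B.umin)) + 1) with hbnd
  have hfib : ∀ ω'' : Fin m' → ℕ, (((T.filter fun ω' => Fin.init ω' = ω'').card : ℕ) : ℝ) ≤ bnd := by
    intro ω''
    -- other legs: `ω₁` and `ω''`; their signs; the counted leg is the last one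
    set ωo : Fin (m' + 1) → ℕ := Fin.cons ω₁ ω'' with hωo
    set so : Fin (m' + 1) → ℝ := Fin.cons (s 0) (fun j : Fin m' => s j.castSucc.succ) with hso
    have hso1 : ∀ i, so i = 1 ∨ so i = -1 := by
      intro i; refine Fin.cases ?_ (fun j => ?_) i
      · simpa [hso] using hs1 0
      · simpa [hso] using hs1 j.castSucc.succ
    set t : ℝ := s (Fin.last m').succ with htdef
    have ht1 : t = 1 ∨ t = -1 := hs1 _
    have key := bgm_lastLeg_count_le' B hμ (hh'.trans hh) hlo hhi he ωo so hso1 t ht1 G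
    refine le_trans ?_ key
    -- inject the fibre into the last-leg set via `ω' ↦ ω' (last)`
    have hinj : Set.InjOn (fun ω' : Fin (m' + 1) → ℕ => ω' (Fin.last m'))
        ((T.filter fun ω' => Fin.init ω' = ω'') : Set (Fin (m' + 1) → ℕ)) := by
      intro x hx y hy hxy
      rw [Finset.mem_coe, Finset.mem_filter] at hx hy
      have hxy' : x (Fin.last m') = y (Fin.last m') := hxy
      have : Fin.init x = Fin.init y := hx.2.trans hy.2.symm
      calc x = Fin.snoc (Fin.init x) (x (Fin.last m')) := (Fin.snoc_init_self x).symm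
        _ = Fin.snoc (Fin.init y) (y (Fin.last m')) := by rw [this, hxy']
        _ = y := Fin.snoc_init_self y
    have hmapsto : Set.MapsTo (fun ω' : Fin (m' + 1) → ℕ => ω' (Fin.last m'))
        ((T.filter fun ω' => Fin.init ω' = ω'') : Set (Fin (m' + 1) → ℕ))
        (((Finset.range (anisoCount h')).filter fun ω : ℕ => ∃ ks : Fin (m' + 1) → Fin 2 → ℝ, ∃ k : Fin 2 → ℝ,
          (∀ i, ks i ∈ sSector 4 e₀ μ (fun _ => sqDispersion) h' (ωo i) ∧ ∀ c, |ks i c| ≤ π) ∧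
          (k ∈ sSector 4 e₀ μ (fun _ => sqDispersion) h' ω ∧ ∀ c, |k c| ≤ π) ∧
          ∀ c : Fin 2, (∑ i, so i * ks i c) + t * k c = 2 * π * G c) : Set ℕ) := by
      intro ω' hω'
      rw [Finset.mem_coe, Finset.mem_filter, hT, Finset.mem_filter, Fintype.mem_piFinset] at hω'
      obtain ⟨⟨hmem, hadm⟩, hinit⟩ := hω'
      rw [Finset.mem_coe, Finset.mem_filter, Finset.mem_range]
      have hlast : ω' (Fin.last m') < anisoCount h' := by
        have := hmem (Fin.last m')
        rw [hch] at this; dsimp only at this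
        exact (Finset.mem_range.1 (Finset.mem_filter.1 this).1)
      refine ⟨hlast, ?_⟩
      obtain ⟨k, hk, hk0, hks, hsum⟩ := hadm
      refine ⟨Fin.cons (k 0) (fun j : Fin m' => k j.castSucc.succ), k (Fin.last m').succ, ?_, ⟨hks (Fin.last m'), hk _⟩, ?_⟩
      · intro i
        refine Fin.cases ?_ (fun j => ?_) i
        · exact ⟨by simpa [hωo] using hk0, by simpa using hk 0⟩
        · refine ⟨?_, by simpa using hk j.castSucc.succ⟩
          have hj := hks j.castSucc
          have : ω' j.castSucc = ω'' j := by rw [← hinit]; rfl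
          simpa [hωo, this] using hj
      · intro c
        have h1 := hsum c
        simp only [hsk] at h1
        rw [Fin.sum_univ_succ, Fin.sum_univ_castSucc] at h1
        rw [Fin.sum_univ_succ]
        simpa [hso, htdef, add_assoc] using h1
    exact_mod_cast Finset.card_le_card_of_injOn _ hmapsto hinj
  -- (4) assemble: `ncard ≤ |T| = Σ fibres ≤ |piFinset ch₀| · bnd = (2^{n'-n})^{m'} · bnd`
  have hpi : (Fintype.piFinset ch₀).card = (2 ^ (n' - n)) ^ m' := by
    rw [Fintype.card_piFinset, Finset.prod_congr rfl fun i _ => hchcard i.castSucc, Finset.prod_const,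
      Finset.card_univ, Fintype.card_fin]
  calc _ ≤ ((T.card : ℕ) : ℝ) := by exact_mod_cast hncard
    _ = ∑ ω'' ∈ Fintype.piFinset ch₀, (((T.filter fun ω' => Fin.init ω' = ω'').card : ℕ) : ℝ) := by
        rw [hdec]; push_cast; rfl
    _ ≤ ∑ _ω'' ∈ Fintype.piFinset ch₀, bnd := Finset.sum_le_sum fun ω'' _ => hfib ω''
    _ = ((2 : ℝ) ^ (n' - n)) ^ m' * bnd := by
        rw [Finset.sum_const, nsmul_eq_mul, hpi]; push_cast; ring

end BGM

end Summit.HubbardSuperconductivity.HubbardSuperconductivity.Theorems.RelativeSectorCount
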